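/-
Copyright (c) 2026. All rights reserved.
Released under Apache 2.0 license as described in the file LICENSE.
Authors: abc-iut cell — abc-iut-w4-d064 (ruling α18 (4): (J) final composition), over abc-iut-w4-d080's per-pair Cor. 3.9 closers and abc-iut-L3-t8's finite-graph Thm. 3.7 (iii).
-/
import Literature.AnabelianGeometry.SemiGraphs.TemperedCompactInVerticialFinite
import Literature.AnabelianGeometry.SemiGraphs.TemperedReconstructionCor39UpToTwistProofsAt
import HarnessLib

/-!
# [SemiAnbd] Corollary 3.9 for FINITE semi-graphs of anabelioids — UNCONDITIONAL (up to twist)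

Mochizuki, *Semi-graphs of anabelioids*, Publ. RIMS **42** (2006), §3, Corollary 3.9, ms pp. 42–43 (proof
p. 43: "by Theorem 3.7, (iii), (iv)") [cite: MochizukiSemiAnbd2006, Cor 3.9 pp.42-43].  PROOF-ONLY (0
defs), the (J) composition of cell ruling α18 (4): abc-iut-w4-d080's per-pair closer of record
`cor39UpToTwistAt (h𝒢iii : CompactInVerticialAt 𝒢) (hℋiii : CompactInVerticialAt ℋ)` and its named-currency form `cor39CompatUpToTwistAt` (φ2 TOP / (P)At; steps
(R0′)/(R2′) abc-iut-w4-d083, (R3) abc-iut-w4-d064, (iv)-at-a-graph abc-iut-w4-d075, graph level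
abc-iut-L3-d1/L3-t2) with BOTH Thm. 3.7 (iii) inputs DISCHARGED for finite graphs by abc-iut-L3-t8's
`compactInVerticialAt_of_finiteGraph` (`TemperedCompactInVerticialFinite.lean`: the Galois tower of
abc-iut-L3-t9, the (β)-3 branch-pair dictionary of abc-iut-L3-t11, (I0c)/(I0v)/v4 of abc-iut-L3-t6, the
(I4′)_cpt consumer chain `TemperedCompactInVerticialCpt.lean`).  RESULT: for every pair of FINITE
`𝒢`, `ℋ` satisfying the hypotheses of Cor. 3.9 and every pair of charts, (a) a homomorphism
`π₁^temp(𝒢) → π₁^temp(ℋ)` induced up to twist by a locally open morphism is compatibly quasi-geometric,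
and (b) every compatibly quasi-geometric homomorphism is so induced by a locally open morphism, whose
underlying morphism of semi-graphs is unique — with NO residual hypothesis (print's p. 41 finiteness of
the `𝔾_j` is exactly our `Finite` binders).  "Induced" is read up to the 2-cells of Rmk. 2.4.2 (cell
ruling ξ2); the literal chosen-conjugator reading (`Cor39`) stays open-as-typed.  Nothing here takes a
side on [IUTchIII] Cor. 3.12.
-/

open CategoryTheory

namespace Literature.AnabelianGeometry.SemiGraphs

namespace ProfiniteSemiGraph

universe u

variable {𝒢 ℋ : ProfiniteSemiGraph.{u}}

/-- **[SemiAnbd] Corollary 3.9 for FINITE `𝒢`, `ℋ` — unconditional, up to twist**: (a) induced-up-to-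
twist by a locally open morphism ⇒ compatibly quasi-geometric; (b) compatibly quasi-geometric ⇒ induced
up to twist by a locally open morphism with unique vertex and edge maps.
[cite: MochizukiSemiAnbd2006, Cor 3.9 pp.42-43] -/
theorem cor39UpToTwistAt_of_finite [Finite 𝒢.graph.Vertex] [Finite 𝒢.graph.Edge]
    [Finite ℋ.graph.Vertex] [Finite ℋ.graph.Edge] (h𝒢 : Cor39Hypotheses 𝒢) (hℋ : Cor39Hypotheses ℋ)
    (c𝒢 : TemperedPiChart 𝒢) (cℋ : TemperedPiChart ℋ) :
    (∀ (F : Hom 𝒢 ℋ), F.IsLocallyOpen → ∀ φ : c𝒢.G →ₜ* cℋ.G,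
        (∃ θ : F.ConjugatorFamily, Nonempty (F.chartPullbackWith θ c𝒢 cℋ ≅ BTemp.res φ)) →
          IsCompatiblyQuasiGeometric φ) ∧
      ∀ φ : c𝒢.G →ₜ* cℋ.G, IsCompatiblyQuasiGeometric φ →
        ∃ F : Hom 𝒢 ℋ, F.IsLocallyOpen ∧
          (∃ θ : F.ConjugatorFamily, Nonempty (F.chartPullbackWith θ c𝒢 cℋ ≅ BTemp.res φ)) ∧
          ∀ F' : Hom 𝒢 ℋ, F'.IsLocallyOpen →
            (∃ θ' : F'.ConjugatorFamily, Nonempty (F'.chartPullbackWith θ' c𝒢 cℋ ≅ BTemp.res φ)) →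
              F'.base.vertexMap = F.base.vertexMap ∧ F'.base.edgeMap = F.base.edgeMap :=
  cor39UpToTwistAt compactInVerticialAt_of_finiteGraph compactInVerticialAt_of_finiteGraph h𝒢 hℋ c𝒢 cℋ

/-- **The same with FULL uniqueness of the underlying morphism of semi-graphs** (vertex, edge and branch
maps), for FINITE `𝒢`, `ℋ` — unconditional. [cite: MochizukiSemiAnbd2006, Cor 3.9 pp.42-43] -/
theorem cor39UpToTwist_baseAt_of_finite [Finite 𝒢.graph.Vertex] [Finite 𝒢.graph.Edge]
    [Finite ℋ.graph.Vertex] [Finite ℋ.graph.Edge] (h𝒢 : Cor39Hypotheses 𝒢) (hℋ : Cor39Hypotheses ℋ)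
    (c𝒢 : TemperedPiChart 𝒢) (cℋ : TemperedPiChart ℋ) :
    (∀ (F : Hom 𝒢 ℋ), F.IsLocallyOpen → ∀ φ : c𝒢.G →ₜ* cℋ.G,
        (∃ θ : F.ConjugatorFamily, Nonempty (F.chartPullbackWith θ c𝒢 cℋ ≅ BTemp.res φ)) →
          IsCompatiblyQuasiGeometric φ) ∧
      ∀ φ : c𝒢.G →ₜ* cℋ.G, IsCompatiblyQuasiGeometric φ →
        ∃ F : Hom 𝒢 ℋ, F.IsLocallyOpen ∧
          (∃ θ : F.ConjugatorFamily, Nonempty (F.chartPullbackWith θ c𝒢 cℋ ≅ BTemp.res φ)) ∧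
          ∀ F' : Hom 𝒢 ℋ, F'.IsLocallyOpen →
            (∃ θ' : F'.ConjugatorFamily, Nonempty (F'.chartPullbackWith θ' c𝒢 cℋ ≅ BTemp.res φ)) →
              F'.base = F.base :=
  cor39UpToTwist_baseAt compactInVerticialAt_of_finiteGraph compactInVerticialAt_of_finiteGraph h𝒢 hℋ
    c𝒢 cℋ

/-- **[SemiAnbd] Corollary 3.9 for FINITE `𝒢`, `ℋ` in the NAMED currency `InducesUpToTwist`** (the body
of abc-iut-w4-d080's `Cor39CompatUpToTwist` at the pair) — unconditional: (a) `F.InducesUpToTwist φ` for a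
locally open `F` ⇒ `φ` compatibly quasi-geometric; (b) every compatibly quasi-geometric `φ` is
`InducesUpToTwist`-induced by a locally open `F`, unique as a morphism of the underlying semi-graphs.
[cite: MochizukiSemiAnbd2006, Cor 3.9 pp.42-43] -/
theorem cor39CompatUpToTwistAt_of_finite [Finite 𝒢.graph.Vertex] [Finite 𝒢.graph.Edge]
    [Finite ℋ.graph.Vertex] [Finite ℋ.graph.Edge] (h𝒢 : Cor39Hypotheses 𝒢) (hℋ : Cor39Hypotheses ℋ)
    (c𝒢 : TemperedPiChart 𝒢) (cℋ : TemperedPiChart ℋ) :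
    (∀ (F : Hom 𝒢 ℋ), F.IsLocallyOpen → ∀ φ : c𝒢.G →ₜ* cℋ.G, F.InducesUpToTwist c𝒢 cℋ φ →
        IsCompatiblyQuasiGeometric φ) ∧
      ∀ φ : c𝒢.G →ₜ* cℋ.G, IsCompatiblyQuasiGeometric φ →
        ∃ F : Hom 𝒢 ℋ, F.IsLocallyOpen ∧ F.InducesUpToTwist c𝒢 cℋ φ ∧
          ∀ F' : Hom 𝒢 ℋ, F'.IsLocallyOpen → F'.InducesUpToTwist c𝒢 cℋ φ → F'.base = F.base :=
  cor39CompatUpToTwistAt compactInVerticialAt_of_finiteGraph compactInVerticialAt_of_finiteGraph h𝒢 hℋ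
    c𝒢 cℋ

end ProfiniteSemiGraph

end Literature.AnabelianGeometry.SemiGraphs
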